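import Summits.HodgeConjecture.HodgeConjecture.Theorems.HodgeLocusCensusInclusionRankBetti

/-!
# Hodge locus census — the modular homology of the Boolean inclusion complex: subadditivity and complement duality (PROBE 32)

certified instances and evidence bearing on the general Hodge conjecture; no claim.  Theorem-only helper sheet of the inclusion-block line
(anchors 283 `…InclusionRankFiltration` (Wilson's identity `incl_mul_incl`), 293 `…InclusionRankComplement` (`rank_incl_eq_rank_incl_compl`,
`cast_factorial_ne_zero`), 340 `…UnitColumnRankDropExact`, 345 `…InclusionRankBetti` ((B-cx) `range_vecMulLinear_le_ker`, the Betti law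
`finrank_ker_add_eq`)); nothing here is a statement about Hodge loci.

WHAT.  `α` a finite set, `K` a field of prime characteristic `p`, `W_{s,t}` the inclusion matrix of the `s`-subsets against the `t`-subsets of `α`
(`[S ⊆ U]`; rows `{S : Finset α // S.card = s}`, anchor 283's matrices verbatim), acting on row vectors, `x ↦ x · W_{s,t}` (`Matrix.vecMulLinear`).
By Wilson's identity `W_{s,t} · W_{t,n} = C(n−s, t−s) · W_{s,n}` (anchor 283) the ladder of row spaces with steps `p − c` and `c`,
`K^{#{S : #S = T−(p−c)}} →(W) K^{#{S : #S = T}} →(W) K^{#{S : #S = T+c}}`, is a complex in characteristic `p` (anchor 345 (B-cx):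
`rowspace W_{T−(p−c),T} ≤ leftker W_{T,T+c}` for `0 < c < p`, `p − c ≤ T`), and its homology
    `H_(c)(T) := leftker W_{T,T+c} ⧸ rowspace W_{T−(p−c),T}`    (typed `↥ker ⧸ Submodule.comap ker.subtype range`, in anchor 345's texts)
has the dimension that anchor 345's Betti law computes (zero below the middle, anchor 340 (EX-ker)).  This sheet proves two STRUCTURE LAWS of
these dimensions, valid at every level of the honest range, with no window hypothesis (after §2 (HOM) `finrank_homology_add_wilson_sum_eq`,
which merely reads anchor 345's Betti law, in its window and hypotheses verbatim, as `dim H_(c)(T) + S_p(#α, T+c) = S_p(#α, T)`):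
  §2 (SUB) `finrank_homology_subadditive` — for `0 < a`, `0 < b`, `a + b < p` and `p − a ≤ T`:
         `dim H_(a+b)(T) ≤ dim H_(a)(T) + dim H_(b)(T + a)`.
     This is the dimension shadow of the exactness of `H_(a)(T) →([x] ↦ [x]) H_(a+b)(T) →([x] ↦ [x · W_{T,T+a}]) H_(b)(T + a)`, the basic lemma of
     `N`-complexes (M. Dubois-Violette, «d^N = 0», K-Theory 14 (1998) 371–404, doi:10.1023/a:1007786403736 = arXiv:q-alg/9710021, LEMMA 1, first
     sequence of the hexagon; M. M. Kapranov, arXiv:q-alg/9611005, Theorem 1.3 and (1.12)) in the Boolean model with `N = p`.  The proof here is two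
     rank–nullity counts for `x ↦ x · W_{T,T+a}`: restricted to `leftker W_{T,T+a+b}` its kernel is `leftker W_{T,T+a}` (§1 `ker_le_ker`: left
     kernels grow along the ladder — Wilson's identity with the unit `C(a+b, a)`) and its image lies in `leftker W_{T+a,T+a+b}`; restricted to
     `rowspace W_{T−(p−a−b),T}` its image IS `rowspace W_{T+a−(p−b),T+a}` (§1 `map_range_eq`, unit `C(p−b, p−a−b)`)
     and its kernel contains `rowspace W_{T−(p−a),T}` (§1 `range_le_range`, unit `C(p−a, b)`, and (B-cx)).
  §3 (PD) `finrank_homology_eq_compl` — for `0 < c < p`, `p − c ≤ T` and `T + c ≤ #α`: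
         `dim H_(c)(T) = dim H_(p−c)(#α − T)`.
     Complementation `S ↦ Sᶜ` reverses the ladder and exchanges the two differentials; in rank form this is anchor 293 (C1) twice,
     `#{S : #S = T} = #{S : #S = #α − T}` (`Fintype.card_finset_len`, `Nat.choose_symm`) and rank–nullity.
  §1 tools: `cast_choose_ne_zero` (`C(n, i)` is a unit mod `p` for `i ≤ n < p`, from anchor 293's `cast_factorial_ne_zero`); level transport
     `ker_eq_ker_of_eq` / `range_eq_range_of_eq` / `rank_eq_rank_of_eq` (a level may be re-spelled: `subst; rfl`); `ker_le_ker`, `range_le_range`,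
     `map_range_eq` (kernels grow, images shrink and move along the ladder inside one period `< p`).
RELATION TO THE CENSUS LINE.  The census ladder of the unit-column model (`×q^c` on `K[x]/(xᵢ^{e+2})`) is block-diagonal with blocks these inclusion
complexes (anchor 345's header; anchor 222's fibre equivalences); (SUB) and (PD) are the block-level laws.  Their census-level forms are successor
material and are NOT asserted here.
NUMERICS FIRST (owner, file-backed under `HOME/pub-hlocus-ivhs-2/gen58/probe32/`): `w_numerics.py` → `w_local.out` — exact linear algebra over
`GF(p)`, `p ∈ {2,3,5,7}`, `#α ≤ 10`, every admissible `(a, b, T)` / `(c, T)`: (HOM) 155 window instances (104 with `dim H > 0`), (SUB) 606 instances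
(419 with equality, 187 strict), (PD) 261 instances, (CX) 261 products `W_{T−(p−c),T} · W_{T,T+c} ≡ 0` — 0 violations.  Counts are repeated in the READY line.
LITERATURE (context only; nothing imported or minted): the exact hexagon of `N`-complex homologies (Dubois-Violette, LEMMA 1; Kapranov, Theorem 1.3);
the inclusion `p`-complex of the Boolean lattice and its homology (V. B. Mnukhin & J. Siemons, J. Combin. Theory Ser. A 74 (1996),
doi:10.1006/jcta.1996.0051; cited in anchor 340's header).  No literature fact is used as a hypothesis.
EVIDENCE CLASS: kernel theorems about inclusion matrices of a finite Boolean lattice; no census number changes; nothing here asserts anything about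
the Hodge conjecture.

Import: anchor 345 `…Theorems.HodgeLocusCensusInclusionRankBetti` BY NAME (hence anchors 283, 293, 340); theorem-only, definition-free.
-/

set_option linter.dupNamespace false
set_option autoImplicit false

namespace Summit.HodgeConjecture.HodgeConjecture.HodgeLocus.Census.InclusionHomology

open Summit.HodgeConjecture.HodgeConjecture.HodgeLocus.Census.InclusionRankFiltration (incl_mul_incl)
open Summit.HodgeConjecture.HodgeConjecture.HodgeLocus.Census.InclusionRankComplement (cast_factorial_ne_zero rank_incl_eq_rank_incl_compl)
open Summit.HodgeConjecture.HodgeConjecture.HodgeLocus.Census.InclusionRankBetti (range_vecMulLinear_le_ker finrank_ker_add_eq)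

/-! ## §1 tools: binomial units below `p`, level transport -/

/-- a binomial coefficient `C(n, i)` with `n < p` is a unit in characteristic `p`. -/
theorem cast_choose_ne_zero (K : Type*) [Field K] (p : ℕ) [CharP K p] (hp : p.Prime) (n i : ℕ) (hnp : n < p) (hin : i ≤ n) :
    ((n.choose i : ℕ) : K) ≠ 0 := by
  intro h
  apply cast_factorial_ne_zero K p hp n hnp
  rw [← Nat.choose_mul_factorial_mul_factorial hin, Nat.cast_mul, Nat.cast_mul, h, zero_mul, zero_mul]

/-- level transport for left kernels: the column level may be re-spelled. -/
theorem ker_eq_ker_of_eq (K : Type*) [Field K] {α : Type*} [Fintype α] [DecidableEq α] (t : ℕ) {n₁ n₂ : ℕ} (h : n₁ = n₂) :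
    LinearMap.ker (Matrix.vecMulLinear
      (Matrix.of fun (S : {S : Finset α // S.card = t}) (U : {S : Finset α // S.card = n₁}) => if S.1 ⊆ U.1 then (1 : K) else 0)) =
    LinearMap.ker (Matrix.vecMulLinear
      (Matrix.of fun (S : {S : Finset α // S.card = t}) (U : {S : Finset α // S.card = n₂}) => if S.1 ⊆ U.1 then (1 : K) else 0)) := by
  subst h; rfl

/-- level transport for row spaces: the row level may be re-spelled. -/
theorem range_eq_range_of_eq (K : Type*) [Field K] {α : Type*} [Fintype α] [DecidableEq α] (t : ℕ) {s₁ s₂ : ℕ} (h : s₁ = s₂) :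
    LinearMap.range (Matrix.vecMulLinear
      (Matrix.of fun (S : {S : Finset α // S.card = s₁}) (U : {S : Finset α // S.card = t}) => if S.1 ⊆ U.1 then (1 : K) else 0)) =
    LinearMap.range (Matrix.vecMulLinear
      (Matrix.of fun (S : {S : Finset α // S.card = s₂}) (U : {S : Finset α // S.card = t}) => if S.1 ⊆ U.1 then (1 : K) else 0)) := by
  subst h; rfl

/-- kernels grow along the ladder: `leftker W_{t,t+a} ≤ leftker W_{t,n}` for `t + a ≤ n < t + p`
(`W_{t,t+a} · W_{t+a,n} = C(n−t, a) · W_{t,n}` with a unit coefficient). -/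
theorem ker_le_ker (K : Type*) [Field K] {α : Type*} [Fintype α] [DecidableEq α] (p : ℕ) [CharP K p] (hp : p.Prime) (t a n : ℕ)
    (han : t + a ≤ n) (hnp : n < t + p) :
    LinearMap.ker (Matrix.vecMulLinear
      (Matrix.of fun (S : {S : Finset α // S.card = t}) (U : {S : Finset α // S.card = t + a}) => if S.1 ⊆ U.1 then (1 : K) else 0)) ≤
    LinearMap.ker (Matrix.vecMulLinear
      (Matrix.of fun (S : {S : Finset α // S.card = t}) (U : {S : Finset α // S.card = n}) => if S.1 ⊆ U.1 then (1 : K) else 0)) := by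
  intro x hx
  rw [LinearMap.mem_ker, Matrix.vecMulLinear_apply] at hx ⊢
  have hmul := incl_mul_incl K t (t + a) n (by omega) (α := α)
  have hu : (((n - t).choose (t + a - t) : ℕ) : K) ≠ 0 := cast_choose_ne_zero K p hp _ _ (by omega) (by omega)
  have h2 : Matrix.vecMul x ((Matrix.of fun (S : {S : Finset α // S.card = t}) (U : {S : Finset α // S.card = t + a}) =>
      if S.1 ⊆ U.1 then (1 : K) else 0) *
      (Matrix.of fun (T : {S : Finset α // S.card = t + a}) (V : {S : Finset α // S.card = n}) => if T.1 ⊆ V.1 then (1 : K) else 0)) = 0 := by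
    rw [← Matrix.vecMul_vecMul, hx, Matrix.zero_vecMul]
  rw [hmul, Matrix.vecMul_smul] at h2
  exact (smul_eq_zero.mp h2).resolve_left hu

/-- images shrink along the ladder: `rowspace W_{s,t} ≤ rowspace W_{s',t}` for `s ≤ s' ≤ t`, `t < s + p`
(`W_{s,s'} · W_{s',t} = C(t−s, s'−s) · W_{s,t}` with a unit coefficient). -/
theorem range_le_range (K : Type*) [Field K] {α : Type*} [Fintype α] [DecidableEq α] (p : ℕ) [CharP K p] (hp : p.Prime) (s s' t : ℕ)
    (hss : s ≤ s') (hst : s' ≤ t) (htp : t < s + p) :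
    LinearMap.range (Matrix.vecMulLinear
      (Matrix.of fun (S : {S : Finset α // S.card = s}) (U : {S : Finset α // S.card = t}) => if S.1 ⊆ U.1 then (1 : K) else 0)) ≤
    LinearMap.range (Matrix.vecMulLinear
      (Matrix.of fun (S : {S : Finset α // S.card = s'}) (U : {S : Finset α // S.card = t}) => if S.1 ⊆ U.1 then (1 : K) else 0)) := by
  rintro _ ⟨y, rfl⟩
  have hmul := incl_mul_incl K s s' t hss (α := α)
  have hu : (((t - s).choose (s' - s) : ℕ) : K) ≠ 0 := cast_choose_ne_zero K p hp _ _ (by omega) (by omega)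
  refine ⟨(((t - s).choose (s' - s) : ℕ) : K)⁻¹ • (Matrix.vecMul y (Matrix.of fun (S : {S : Finset α // S.card = s}) (U : {S : Finset α // S.card = s'}) =>
    if S.1 ⊆ U.1 then (1 : K) else 0)), ?_⟩
  rw [Matrix.vecMulLinear_apply, Matrix.vecMulLinear_apply, Matrix.smul_vecMul, Matrix.vecMul_vecMul, hmul, Matrix.vecMul_smul,
    smul_smul, inv_mul_cancel₀ hu, one_smul]

/-- images move along the ladder: `W_{t,n}` maps `rowspace W_{s,t}` ONTO `rowspace W_{s,n}` for `s ≤ t ≤ n < s + p`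
(`W_{s,t} · W_{t,n} = C(n−s, t−s) · W_{s,n}` with a unit coefficient). -/
theorem map_range_eq (K : Type*) [Field K] {α : Type*} [Fintype α] [DecidableEq α] (p : ℕ) [CharP K p] (hp : p.Prime) (s t n : ℕ)
    (hst : s ≤ t) (htn : t ≤ n) (hnp : n < s + p) :
    Submodule.map (Matrix.vecMulLinear
      (Matrix.of fun (S : {S : Finset α // S.card = t}) (U : {S : Finset α // S.card = n}) => if S.1 ⊆ U.1 then (1 : K) else 0))
      (LinearMap.range (Matrix.vecMulLinear
      (Matrix.of fun (S : {S : Finset α // S.card = s}) (U : {S : Finset α // S.card = t}) => if S.1 ⊆ U.1 then (1 : K) else 0))) =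
    LinearMap.range (Matrix.vecMulLinear
      (Matrix.of fun (S : {S : Finset α // S.card = s}) (U : {S : Finset α // S.card = n}) => if S.1 ⊆ U.1 then (1 : K) else 0)) := by
  have hmul := incl_mul_incl K s t n hst (α := α)
  have hu : (((n - s).choose (t - s) : ℕ) : K) ≠ 0 := cast_choose_ne_zero K p hp _ _ (by omega) (by omega)
  apply le_antisymm
  · rintro _ ⟨_, ⟨y, rfl⟩, rfl⟩
    refine ⟨(((n - s).choose (t - s) : ℕ) : K) • y, ?_⟩
    rw [Matrix.vecMulLinear_apply, Matrix.vecMulLinear_apply, Matrix.vecMulLinear_apply, Matrix.vecMul_vecMul, hmul, Matrix.vecMul_smul,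
      Matrix.smul_vecMul]
  · rintro _ ⟨y, rfl⟩
    refine ⟨Matrix.vecMul ((((n - s).choose (t - s) : ℕ) : K)⁻¹ • y) (Matrix.of fun (S : {S : Finset α // S.card = s}) (U : {S : Finset α // S.card = t}) =>
        if S.1 ⊆ U.1 then (1 : K) else 0), ⟨_, rfl⟩, ?_⟩
    rw [Matrix.vecMulLinear_apply, Matrix.vecMulLinear_apply, Matrix.vecMul_vecMul, hmul, Matrix.vecMul_smul, Matrix.smul_vecMul, smul_smul,
      mul_inv_cancel₀ hu, one_smul]

/-! ## §2 (HOM) THE BETTI NUMBER AS A DIMENSION, (SUB) SUBADDITIVITY -/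

/-- **(HOM) the modular Betti number is the dimension of the honest subquotient.**  In anchor 345's window (its hypotheses verbatim),
`dim ( leftker W_{T,T+c} ⧸ rowspace W_{T−(p−c),T} ) + S_p(#α, T + c) = S_p(#α, T)` with anchor 345's Wilson sums `S_p(#α, X) = Σ_{y ≡ X (mod p)} C(#α, y)`
written out as there: anchor 345's Betti law `finrank_ker_add_eq` read through `dim (ker ⧸ range) = dim ker − dim range` ((B-cx) makes the quotient honest). -/
theorem finrank_homology_add_wilson_sum_eq (K : Type*) [Field K] {α : Type*} [Fintype α] [DecidableEq α] (p : ℕ) [CharP K p] (hp : p.Prime)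
    (c T : ℕ) (hc : 0 < c) (hcp : c < p) (hTc : T + c ≤ Fintype.card α) (hpT : p - c ≤ T) (hlo : 2 * T ≤ Fintype.card α + (p - c))
    (hhi : Fintype.card α ≤ 2 * T + c) :
    Module.finrank K (↥(LinearMap.ker (Matrix.vecMulLinear
      (Matrix.of fun (S : {S : Finset α // S.card = T}) (U : {S : Finset α // S.card = T + c}) =>
          if S.1 ⊆ U.1 then (1 : K) else 0))) ⧸
      Submodule.comap (LinearMap.ker (Matrix.vecMulLinear
      (Matrix.of fun (S : {S : Finset α // S.card = T}) (U : {S : Finset α // S.card = T + c}) =>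
          if S.1 ⊆ U.1 then (1 : K) else 0))).subtype
        (LinearMap.range (Matrix.vecMulLinear
      (Matrix.of fun (S : {S : Finset α // S.card = T - (p - c)}) (U : {S : Finset α // S.card = T}) =>
          if S.1 ⊆ U.1 then (1 : K) else 0)))) +
      ((∑ b ∈ Finset.range ((T + c) / p), (Fintype.card α).choose (T + c - (b + 1) * p)) + (Fintype.card α).choose (T + c) +
        ∑ b ∈ Finset.range ((Fintype.card α - (T + c)) / p), (Fintype.card α).choose (T + c + (b + 1) * p)) =
    ((∑ b ∈ Finset.range ((T) / p), (Fintype.card α).choose (T - (b + 1) * p)) + (Fintype.card α).choose (T) +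
        ∑ b ∈ Finset.range ((Fintype.card α - (T)) / p), (Fintype.card α).choose (T + (b + 1) * p)) := by
  have f := range_vecMulLinear_le_ker K p hp (c := c) hc hcp T hpT (α := α)
  have hq := Submodule.finrank_quotient_add_finrank (Submodule.comap (LinearMap.ker (Matrix.vecMulLinear
      (Matrix.of fun (S : {S : Finset α // S.card = T}) (U : {S : Finset α // S.card = T + c}) =>
          if S.1 ⊆ U.1 then (1 : K) else 0))).subtype
        (LinearMap.range (Matrix.vecMulLinear
      (Matrix.of fun (S : {S : Finset α // S.card = T - (p - c)}) (U : {S : Finset α // S.card = T}) =>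
          if S.1 ⊆ U.1 then (1 : K) else 0))))
  rw [LinearEquiv.finrank_eq (Submodule.comapSubtypeEquivOfLe f)] at hq
  have hb := finrank_ker_add_eq K p hp hc hcp T hTc hpT hlo hhi (α := α)
  omega

/-- **(SUB) SUBADDITIVITY.**  Over a field `K` of prime characteristic `p`, for `0 < a`, `0 < b`, `a + b < p` and a level `T ≥ p − a` of the
Boolean lattice of a finite set `α` (inclusion matrices `W_{s,t} = [S ⊆ U]`, left kernels and row spaces of `x ↦ x · W`):
`dim ( leftker W_{T,T+a+b} ⧸ rowspace W_{T−(p−a−b),T} ) ≤ dim ( leftker W_{T,T+a} ⧸ rowspace W_{T−(p−a),T} ) + dim ( leftker W_{T+a,T+a+b} ⧸ rowspace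
W_{T+a−(p−b),T+a} )` — the modular homologies `H_(a+b)(T)`, `H_(a)(T)`, `H_(b)(T+a)` of the `p`-complex `(W, W^p ≡ 0)`; the dimension shadow
of the exactness of `H_(a)(T) → H_(a+b)(T) → H_(b)(T+a)` (`[x] ↦ [x]`, `[x] ↦ [x · W_{T,T+a}]`).  All three subquotients are honest
(anchor 345 (B-cx) at `(c, T) = (a+b, T), (a, T), (b, T+a)`).  Proof: rank–nullity for `x ↦ x · W_{T,T+a}` restricted to `leftker W_{T,T+a+b}`
(kernel `leftker W_{T,T+a}` by `ker_le_ker`, image inside `leftker W_{T+a,T+a+b}`) and restricted to `rowspace W_{T−(p−a−b),T}` (image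
`= rowspace W_{T+a−(p−b),T+a}` by `map_range_eq`, kernel `⊇ rowspace W_{T−(p−a),T}` by `range_le_range` and (B-cx)). -/
theorem finrank_homology_subadditive (K : Type*) [Field K] {α : Type*} [Fintype α] [DecidableEq α] (p : ℕ) [CharP K p] (hp : p.Prime)
    (a b T : ℕ) (ha : 0 < a) (hb : 0 < b) (hab : a + b < p) (hT : p - a ≤ T) :
    Module.finrank K (↥(LinearMap.ker (Matrix.vecMulLinear
      (Matrix.of fun (S : {S : Finset α // S.card = T}) (U : {S : Finset α // S.card = T + (a + b)}) => if S.1 ⊆ U.1 then (1 : K) else 0))) ⧸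
      Submodule.comap (LinearMap.ker (Matrix.vecMulLinear
      (Matrix.of fun (S : {S : Finset α // S.card = T}) (U : {S : Finset α // S.card = T + (a + b)}) => if S.1 ⊆ U.1 then (1 : K) else 0))).subtype
        (LinearMap.range (Matrix.vecMulLinear
      (Matrix.of fun (S : {S : Finset α // S.card = T - (p - (a + b))}) (U : {S : Finset α // S.card = T}) => if S.1 ⊆ U.1 then (1 : K) else 0)))) ≤
    Module.finrank K (↥(LinearMap.ker (Matrix.vecMulLinear
      (Matrix.of fun (S : {S : Finset α // S.card = T}) (U : {S : Finset α // S.card = T + a}) => if S.1 ⊆ U.1 then (1 : K) else 0))) ⧸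
      Submodule.comap (LinearMap.ker (Matrix.vecMulLinear
      (Matrix.of fun (S : {S : Finset α // S.card = T}) (U : {S : Finset α // S.card = T + a}) => if S.1 ⊆ U.1 then (1 : K) else 0))).subtype
        (LinearMap.range (Matrix.vecMulLinear
      (Matrix.of fun (S : {S : Finset α // S.card = T - (p - a)}) (U : {S : Finset α // S.card = T}) => if S.1 ⊆ U.1 then (1 : K) else 0)))) +
    Module.finrank K (↥(LinearMap.ker (Matrix.vecMulLinear
      (Matrix.of fun (S : {S : Finset α // S.card = T + a}) (U : {S : Finset α // S.card = T + a + b}) => if S.1 ⊆ U.1 then (1 : K) else 0))) ⧸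
      Submodule.comap (LinearMap.ker (Matrix.vecMulLinear
      (Matrix.of fun (S : {S : Finset α // S.card = T + a}) (U : {S : Finset α // S.card = T + a + b}) => if S.1 ⊆ U.1 then (1 : K) else 0))).subtype
        (LinearMap.range (Matrix.vecMulLinear
      (Matrix.of fun (S : {S : Finset α // S.card = T + a - (p - b)}) (U : {S : Finset α // S.card = T + a}) =>
          if S.1 ⊆ U.1 then (1 : K) else 0)))) := by
  -- the five inclusions
  have f1 := ker_le_ker K p hp T a (T + (a + b)) (by omega) (by omega) (α := α)
  have f2 := range_vecMulLinear_le_ker K p hp (c := a + b) (by omega) hab T (by omega) (α := α)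
  have f3 := range_vecMulLinear_le_ker K p hp (c := a) ha (by omega) T hT (α := α)
  have f4 := range_vecMulLinear_le_ker K p hp (c := b) hb (by omega) (T + a) (by omega) (α := α)
  have f5 := range_le_range K p hp (T - (p - a)) (T - (p - (a + b))) T (by omega) (by omega) (by omega) (α := α)
  -- the three quotient dimensions
  have hq1 := Submodule.finrank_quotient_add_finrank (Submodule.comap (LinearMap.ker (Matrix.vecMulLinear
      (Matrix.of fun (S : {S : Finset α // S.card = T}) (U : {S : Finset α // S.card = T + (a + b)}) => if S.1 ⊆ U.1 then (1 : K) else 0))).subtype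
        (LinearMap.range (Matrix.vecMulLinear
      (Matrix.of fun (S : {S : Finset α // S.card = T - (p - (a + b))}) (U : {S : Finset α // S.card = T}) => if S.1 ⊆ U.1 then (1 : K) else 0))))
  rw [LinearEquiv.finrank_eq (Submodule.comapSubtypeEquivOfLe f2)] at hq1
  have hq2 := Submodule.finrank_quotient_add_finrank (Submodule.comap (LinearMap.ker (Matrix.vecMulLinear
      (Matrix.of fun (S : {S : Finset α // S.card = T}) (U : {S : Finset α // S.card = T + a}) => if S.1 ⊆ U.1 then (1 : K) else 0))).subtype
        (LinearMap.range (Matrix.vecMulLinear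
      (Matrix.of fun (S : {S : Finset α // S.card = T - (p - a)}) (U : {S : Finset α // S.card = T}) => if S.1 ⊆ U.1 then (1 : K) else 0))))
  rw [LinearEquiv.finrank_eq (Submodule.comapSubtypeEquivOfLe f3)] at hq2
  have hq3 := Submodule.finrank_quotient_add_finrank (Submodule.comap (LinearMap.ker (Matrix.vecMulLinear
      (Matrix.of fun (S : {S : Finset α // S.card = T + a}) (U : {S : Finset α // S.card = T + a + b}) => if S.1 ⊆ U.1 then (1 : K) else 0))).subtype
        (LinearMap.range (Matrix.vecMulLinear
      (Matrix.of fun (S : {S : Finset α // S.card = T + a - (p - b)}) (U : {S : Finset α // S.card = T + a}) => if S.1 ⊆ U.1 then (1 : K) else 0))))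
  rw [LinearEquiv.finrank_eq (Submodule.comapSubtypeEquivOfLe f4)] at hq3
  -- `x ↦ x · W_{T,T+a}` on the big kernel: rank–nullity, kernel, image
  have e2 := LinearMap.finrank_range_add_finrank_ker ((Matrix.vecMulLinear
      (Matrix.of fun (S : {S : Finset α // S.card = T}) (U : {S : Finset α // S.card = T + a}) => if S.1 ⊆ U.1 then (1 : K) else 0)).comp
      (LinearMap.ker (Matrix.vecMulLinear
      (Matrix.of fun (S : {S : Finset α // S.card = T}) (U : {S : Finset α // S.card = T + (a + b)}) => if S.1 ⊆ U.1 then (1 : K) else 0))).subtype)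
  rw [LinearMap.ker_comp, LinearEquiv.finrank_eq (Submodule.comapSubtypeEquivOfLe f1), LinearMap.range_comp, Submodule.range_subtype] at e2
  have g1 : Submodule.map (Matrix.vecMulLinear
      (Matrix.of fun (S : {S : Finset α // S.card = T}) (U : {S : Finset α // S.card = T + a}) => if S.1 ⊆ U.1 then (1 : K) else 0))
      (LinearMap.ker (Matrix.vecMulLinear
      (Matrix.of fun (S : {S : Finset α // S.card = T}) (U : {S : Finset α // S.card = T + (a + b)}) => if S.1 ⊆ U.1 then (1 : K) else 0))) ≤
      LinearMap.ker (Matrix.vecMulLinear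
      (Matrix.of fun (S : {S : Finset α // S.card = T + a}) (U : {S : Finset α // S.card = T + a + b}) => if S.1 ⊆ U.1 then (1 : K) else 0)) := by
    rintro _ ⟨x, hx, rfl⟩
    rw [SetLike.mem_coe, ker_eq_ker_of_eq K T (show T + (a + b) = T + a + b by omega), LinearMap.mem_ker, Matrix.vecMulLinear_apply] at hx
    rw [LinearMap.mem_ker, Matrix.vecMulLinear_apply, Matrix.vecMulLinear_apply, Matrix.vecMul_vecMul,
      incl_mul_incl K T (T + a) (T + a + b) (by omega), Matrix.vecMul_smul, hx, smul_zero]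
  have m1 := Submodule.finrank_mono g1
  -- `x ↦ x · W_{T,T+a}` on the big image: rank–nullity, image, kernel
  have e1 := LinearMap.finrank_range_add_finrank_ker ((Matrix.vecMulLinear
      (Matrix.of fun (S : {S : Finset α // S.card = T}) (U : {S : Finset α // S.card = T + a}) => if S.1 ⊆ U.1 then (1 : K) else 0)).comp
      (LinearMap.range (Matrix.vecMulLinear
      (Matrix.of fun (S : {S : Finset α // S.card = T - (p - (a + b))}) (U : {S : Finset α // S.card = T}) =>
          if S.1 ⊆ U.1 then (1 : K) else 0))).subtype)
  rw [LinearMap.ker_comp, LinearMap.range_comp, Submodule.range_subtype, map_range_eq K p hp (T - (p - (a + b))) T (T + a) (by omega) (by omega)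
    (by omega), range_eq_range_of_eq K (T + a) (show T - (p - (a + b)) = T + a - (p - b) by omega)] at e1
  have m2 : Module.finrank K ↥(Submodule.comap (LinearMap.range (Matrix.vecMulLinear
      (Matrix.of fun (S : {S : Finset α // S.card = T - (p - (a + b))}) (U : {S : Finset α // S.card = T}) =>
          if S.1 ⊆ U.1 then (1 : K) else 0))).subtype
      (LinearMap.range (Matrix.vecMulLinear
      (Matrix.of fun (S : {S : Finset α // S.card = T - (p - a)}) (U : {S : Finset α // S.card = T}) => if S.1 ⊆ U.1 then (1 : K) else 0)))) ≤
      Module.finrank K ↥(Submodule.comap (LinearMap.range (Matrix.vecMulLinear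
      (Matrix.of fun (S : {S : Finset α // S.card = T - (p - (a + b))}) (U : {S : Finset α // S.card = T}) =>
          if S.1 ⊆ U.1 then (1 : K) else 0))).subtype
      (LinearMap.ker (Matrix.vecMulLinear
      (Matrix.of fun (S : {S : Finset α // S.card = T}) (U : {S : Finset α // S.card = T + a}) =>
          if S.1 ⊆ U.1 then (1 : K) else 0)))) := Submodule.finrank_mono (Submodule.comap_mono f3)
  rw [LinearEquiv.finrank_eq (Submodule.comapSubtypeEquivOfLe f5)] at m2
  omega

/-! ## §3 (PD) COMPLEMENT DUALITY OF THE MODULAR HOMOLOGY -/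

/-- level transport for ranks: both levels may be re-spelled. -/
theorem rank_eq_rank_of_eq (K : Type*) [Field K] {α : Type*} [Fintype α] [DecidableEq α] {s₁ s₂ t₁ t₂ : ℕ} (hs : s₁ = s₂) (ht : t₁ = t₂) :
    (Matrix.of fun (S : {S : Finset α // S.card = s₁}) (U : {S : Finset α // S.card = t₁}) => if S.1 ⊆ U.1 then (1 : K) else 0).rank =
    (Matrix.of fun (S : {S : Finset α // S.card = s₂}) (U : {S : Finset α // S.card = t₂}) => if S.1 ⊆ U.1 then (1 : K) else 0).rank := by
  subst hs; subst ht; rfl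

/-- **(PD) COMPLEMENT DUALITY.**  For `0 < c < p`, `p − c ≤ T` and `T + c ≤ #α`:
`dim ( leftker W_{T,T+c} ⧸ rowspace W_{T−(p−c),T} ) = dim ( leftker W_{#α−T,#α−T+(p−c)} ⧸ rowspace W_{#α−T−c,#α−T} )`, i.e.
`dim H_(c)(T) = dim H_(p−c)(#α − T)`: complementation `S ↦ Sᶜ` transposes the complex and exchanges the two differentials `W^c`, `W^(p−c)`
(anchor 293 (C1) `rank W_{t,n} = rank W_{#α−n,#α−t}`, twice), and `#{S : #S = T} = #{S : #S = #α − T}`; both subquotients are honest (anchor 345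
(B-cx) at `(c, T)` and at `(p − c, #α − T)`). -/
theorem finrank_homology_eq_compl (K : Type*) [Field K] {α : Type*} [Fintype α] [DecidableEq α] (p : ℕ) [CharP K p] (hp : p.Prime)
    (c T : ℕ) (hc : 0 < c) (hcp : c < p) (hpT : p - c ≤ T) (hTc : T + c ≤ Fintype.card α) :
    Module.finrank K (↥(LinearMap.ker (Matrix.vecMulLinear
      (Matrix.of fun (S : {S : Finset α // S.card = T}) (U : {S : Finset α // S.card = T + c}) => if S.1 ⊆ U.1 then (1 : K) else 0))) ⧸
      Submodule.comap (LinearMap.ker (Matrix.vecMulLinear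
      (Matrix.of fun (S : {S : Finset α // S.card = T}) (U : {S : Finset α // S.card = T + c}) => if S.1 ⊆ U.1 then (1 : K) else 0))).subtype
        (LinearMap.range (Matrix.vecMulLinear
      (Matrix.of fun (S : {S : Finset α // S.card = T - (p - c)}) (U : {S : Finset α // S.card = T}) => if S.1 ⊆ U.1 then (1 : K) else 0)))) =
    Module.finrank K (↥(LinearMap.ker (Matrix.vecMulLinear
      (Matrix.of fun (S : {S : Finset α // S.card = Fintype.card α - T}) (U : {S : Finset α // S.card = Fintype.card α - T + (p - c)}) =>
          if S.1 ⊆ U.1 then (1 : K) else 0))) ⧸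
      Submodule.comap (LinearMap.ker (Matrix.vecMulLinear
      (Matrix.of fun (S : {S : Finset α // S.card = Fintype.card α - T}) (U : {S : Finset α // S.card = Fintype.card α - T + (p - c)}) =>
          if S.1 ⊆ U.1 then (1 : K) else 0))).subtype
        (LinearMap.range (Matrix.vecMulLinear
      (Matrix.of fun (S : {S : Finset α // S.card = Fintype.card α - T - (p - (p - c))}) (U : {S : Finset α // S.card = Fintype.card α - T}) =>
          if S.1 ⊆ U.1 then (1 : K) else 0)))) := by
  have f := range_vecMulLinear_le_ker K p hp (c := c) hc hcp T hpT (α := α)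
  have f' := range_vecMulLinear_le_ker K p hp (c := p - c) (by omega) (by omega) (Fintype.card α - T) (by omega) (α := α)
  have hq := Submodule.finrank_quotient_add_finrank (Submodule.comap (LinearMap.ker (Matrix.vecMulLinear
      (Matrix.of fun (S : {S : Finset α // S.card = T}) (U : {S : Finset α // S.card = T + c}) => if S.1 ⊆ U.1 then (1 : K) else 0))).subtype
        (LinearMap.range (Matrix.vecMulLinear
      (Matrix.of fun (S : {S : Finset α // S.card = T - (p - c)}) (U : {S : Finset α // S.card = T}) => if S.1 ⊆ U.1 then (1 : K) else 0))))
  rw [LinearEquiv.finrank_eq (Submodule.comapSubtypeEquivOfLe f)] at hq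
  have hq' := Submodule.finrank_quotient_add_finrank (Submodule.comap (LinearMap.ker (Matrix.vecMulLinear
      (Matrix.of fun (S : {S : Finset α // S.card = Fintype.card α - T}) (U : {S : Finset α // S.card = Fintype.card α - T + (p - c)}) =>
          if S.1 ⊆ U.1 then (1 : K) else 0))).subtype
        (LinearMap.range (Matrix.vecMulLinear
      (Matrix.of fun (S : {S : Finset α // S.card = Fintype.card α - T - (p - (p - c))}) (U : {S : Finset α // S.card = Fintype.card α - T}) =>
          if S.1 ⊆ U.1 then (1 : K) else 0))))
  rw [LinearEquiv.finrank_eq (Submodule.comapSubtypeEquivOfLe f')] at hq'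
  -- ranks of the four maps
  have hr : ∀ (s t : ℕ), Module.finrank K ↥(LinearMap.range (Matrix.vecMulLinear
      (Matrix.of fun (S : {S : Finset α // S.card = s}) (U : {S : Finset α // S.card = t}) => if S.1 ⊆ U.1 then (1 : K) else 0))) =
      (Matrix.of fun (S : {S : Finset α // S.card = s}) (U : {S : Finset α // S.card = t}) => if S.1 ⊆ U.1 then (1 : K) else 0).rank := by
    intro s t
    rw [← Matrix.mulVecLin_transpose, ← Matrix.rank_transpose]
    rfl
  have hk : ∀ (s t : ℕ), Module.finrank K ↥(LinearMap.ker (Matrix.vecMulLinear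
      (Matrix.of fun (S : {S : Finset α // S.card = s}) (U : {S : Finset α // S.card = t}) => if S.1 ⊆ U.1 then (1 : K) else 0))) +
      (Matrix.of fun (S : {S : Finset α // S.card = s}) (U : {S : Finset α // S.card = t}) =>
          if S.1 ⊆ U.1 then (1 : K) else 0).rank = (Fintype.card α).choose s := by
    intro s t
    rw [← hr, add_comm, LinearMap.finrank_range_add_finrank_ker, Module.finrank_fintype_fun_eq_card, Fintype.card_finset_len]
  have hk1 := hk T (T + c)
  have hk2 := hk (Fintype.card α - T) (Fintype.card α - T + (p - c))
  have hr1 := hr (T - (p - c)) T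
  have hr2 := hr (Fintype.card α - T - (p - (p - c))) (Fintype.card α - T)
  -- complementation
  have c1 := rank_incl_eq_rank_incl_compl K T (T + c) (by omega) hTc (α := α)
  rw [rank_eq_rank_of_eq K (show Fintype.card α - (T + c) = Fintype.card α - T - (p - (p - c)) by omega) (show Fintype.card α - T = Fintype.card α - T from rfl)] at c1
  have c2 := rank_incl_eq_rank_incl_compl K (T - (p - c)) T (by omega) (by omega) (α := α)
  rw [rank_eq_rank_of_eq K (show Fintype.card α - T = Fintype.card α - T from rfl) (show Fintype.card α - (T - (p - c)) = Fintype.card α - T + (p - c) by omega)] at c2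
  have c3 : (Fintype.card α).choose (Fintype.card α - T) = (Fintype.card α).choose T := Nat.choose_symm (by omega)
  omega

end Summit.HodgeConjecture.HodgeConjecture.HodgeLocus.Census.InclusionHomology
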